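import Literature.MathematicalPhysics.QuantumFieldTheory.Balaban1983to89.Beta.RemainderResidueFamily
import Literature.MathematicalPhysics.QuantumFieldTheory.Balaban1983to89.Beta.RemainderConstCertified
import Summits.QuantumFields.BalabanUV.Gaps.CapSignsConstRoad
import Summits.QuantumFields.BalabanUV.Gaps.CapSignsRefutationSocket

/-!
# Gaps / CapSchemeSocketWeakest — the SCHEME-form CAP sockets of [I] Theorem 2 AS TYPED at their WEAKEST, print-faithful binders: across
# Bałaban's ε₁-family the hypothesis ∕ conclusion is «for ε₁ sufficiently small» (not «for every ε₁» ∕ «for some ε₁»), and the «common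
# one-loop coefficients» binder is used ONE-SIDEDLY (majorant on the refutation road, minorant on the confirmation road)  (cell pub-balaban-gaps,
# seat g1-p3 gen 4, CAP+tail charge; §§1–4 ADOPT g1-plan-2 GEN 10's lens kernel `g1/skeletons/XreadSchemeSocketWeakest_plan2.lean` v4
# 89567fc414f9f85b §§1–4 (X-59 ∕ X-60 ∕ X-64 ∕ X-65) byte-for-byte up to this header, the namespace and two cross-references in docstrings, on
# the planner's «your call ∕ no refusal» disposition [G1-PLAN2-G10-X64] ∕ [-X65]; §5 — the concrete sockets with the one-box exit DISCHARGED by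
# this seat's `CapSignsRefutationSocket` — is this seat's; the kernel's §5 (X-66) rides with the companion `Gaps/CapSignListLength`)

HONEST FRAMING (cell rule, page 1 of everything): bookkeeping over hypothesis SHAPES of the tree's β sub-cell; NOTHING of Bałaban's is asserted
beyond print; [Balaban1987RG1] Thm 2 is UNPROVED IN PRINT and enters only as the hypothesis ∕ conclusion `B12.Thm2Printed (Cf e) L`; NO coefficient
of Bałaban's β⁰ and NO enclosure of his β_{k+1} is certified to date (b2b BETA/CERT.md: «0 coefficients»); `EpsFamily` (g1-p2's
`Beta.RemainderResidueFamily`) is a HYPOTHESIS SHAPE typed from [II] p. 21, inhabited for Bałaban's objects 0∕1; 0 binders discharged; NOT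
`BetaPertH`, NOT the continuum limit, NOT Clay.  HONEST DEPENDENCY (b2b cell, verbatim): «continuum YM on T⁴ ⇐ BetaPertH ∧ nine spine estimates
(0/9 proved); BetaPertH ⇐ (D1) ∧ (D4) ∧ CAP+tail; G-an2-4 gates asym, D1 and NE2/3/4.»

CONTENT (what is weakened, by name).
§1 (X-59) `exists_member_exit_of_oneBox` ∕ `hmem_of_common_and_fam` ∕ `exists_member_exit`: the scheme-form NEGATIVE socket stated ABSTRACTLY over a
   predicate `T e` («Theorem 2 holds for member e») and the per-member ONE-BOX exit — it consumes the family at ONE slope, the UPPER half of the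
   remainder only, at the ONE scale under test, and the common-coefficient binder only at index `k` and only as `≤`.
§2 (X-60) `coeff_nonneg_of_eventually` (+ `EpsFamily` suppliers `member_threshold_of_epsFamily`, `exists_small_member_remainderConst_of_epsFamily`,
   `hthr_of_epsFamily`; assembled `coeff_nonneg_of_eventually_epsFamily`, `exists_small_member_exit_of_epsFamily`): the Theorem-2 hypothesis of
   (N1)-in-the-scheme (this seat's `CapSignsRefutationSocket.beta0_nonneg_of_thm2Printed_scheme` asks it of EVERY member `e > 0`) can be the
   PRINT-FAITHFUL «∃ ε₀ > 0, ∀ e ∈ ]0,ε₀], T e» ([II] p. 21 «ε₁ sufficiently small»), because `EpsFamily` delivers members below every threshold.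
§3 (X-64) `forall_small_member_of_epsFamily` ∕ `forall_small_member_thm2Printed_of_beta0Floor` ∕ `scheme_threshold_summary`: on the POSITIVE side the
   tree's `CapSignsConstRoad.exists_member_thm2Printed_of_beta0Floor` («∃ ONE member with Theorem 2») strengthens, same hypotheses, to the
   print-faithful «Theorem 2 for ALL sufficiently small members».
§4 (X-65) `minorant_of_common`, `forall_small_member_thm2Printed_of_minorantFloor` ∕ `_of_minorantSigns`, `exists_member_thm2Printed_of_minorantSigns`:
   the binder `hβ0 : ∀ e > 0, (Sf e).β0 = b0` («one-loop coefficients COMMON to the ε₁-members», an un-adjudicated READING) is used ONE-SIDEDLY —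
   a common certified MINORANT `b0 ≤ (Sf e).β0` carrying floor ∕ signs + tail suffices; no commonness claim is ever load-bearing.
§5 (this seat) THE CONCRETE SCHEME SOCKETS AT THE PRINT-FAITHFUL QUANTIFIER, the one-box exit `hexit` DISCHARGED by
   `CapSignsRefutationSocket.not_thm2Printed_of_beta0_neg_oneBox`: `beta0_majorant_nonneg_of_thm2Printed_smallMembers` ((N1) in the scheme:
   Theorem 2 for all SMALL members ⟹ every common majorant of their `k`-th coefficients is `≥ 0`), `exists_small_member_not_thm2Printed_of_majorant_neg`
   (+ `_cert`: a certified common majorant `< 0` at ONE scale ⟹ below EVERY threshold some member violates Theorem 2 — the print-faithful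
   negation; `_small`: the majorant over SMALL members only — g1-plan-2 GEN 11's X-69(b), adopted), `scheme_twoSidedTest` (both directions packaged; equality of the members' coefficients never used).  The tree's
   `beta0_nonneg_of_thm2Printed_epsFamily` ∕ `exists_member_not_thm2Printed_of_beta0_neg` are the corollary cases «every member» ∕ equality `hβ0`.
READING for row CAP-k (what a certificate must deliver on the scheme road, at its weakest): an ε₁-UNIFORM certified INTERVAL for β⁰_{k+1} —
a minorant with floor ∕ signs + tail (confirmation, for all small ε₁) or a majorant `< 0` at ONE scale (refutation, below every threshold).
All [folklore]; 0 sorry; 0 def; imports tree files only; restates nothing (the tree's theorems are used by name).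
-/


namespace Summit.QuantumFields.BalabanUV.Gaps.CapSchemeSocketWeakest

open Literature.MathematicalPhysics.QuantumFieldTheory.Balaban1983to89
open Literature.MathematicalPhysics.QuantumFieldTheory.Balaban1983to89.FlowStep
open Literature.MathematicalPhysics.QuantumFieldTheory.Balaban1983to89.Beta.RemainderChain (RemainderConst)
open Literature.MathematicalPhysics.QuantumFieldTheory.Balaban1983to89.DagBinding
open Literature.MathematicalPhysics.QuantumFieldTheory.Balaban1983to89.Beta.RateCertificate (GeomRate)
open Literature.MathematicalPhysics.QuantumFieldTheory.Balaban1983to89.Beta.RemainderConstCertified (thm2Printed_of_floor_const)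
open Summit.QuantumFields.BalabanUV.Gaps.CapSignsConstRoad (exists_beta0Floor_of_signs)
open Literature.MathematicalPhysics.QuantumFieldTheory.Balaban1983to89.Beta.RemainderResidue (AtSlope remainderConst_of_atSlope remainderConst_restrict)
open Literature.MathematicalPhysics.QuantumFieldTheory.Balaban1983to89.Beta.RemainderResidueFamily (EpsFamily)
open Summit.QuantumFields.BalabanUV.Gaps.CapSignsRefutationSocket (not_thm2Printed_of_beta0_neg_oneBox)

noncomputable section

/-! ## §1 (X-59) The scheme-form negative socket = the one-box exit at ONE member -/

/-- **X-59.**  Abstract scheme socket: if every member `e` has the ONE-BOX exit (`β¹_{k+1} ≤ −β⁰_{k+1}` on one small box ⟹ `¬ T e`),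
then ONE member whose `k`-th coefficient is `≤ c < 0` and whose remainder is `≤ −c` FROM ABOVE on ONE box AT SCALE `k` already
violates `T`.  This is all that `CapSignsRefutationSocket.exists_member_not_thm2Printed_of_beta0_neg` consumes of `hβ0` and `hfam`. [folklore] -/
theorem exists_member_exit_of_oneBox {βf : ℝ → HBeta} (Sf : (e : ℝ) → B12Beta.OneLoopSplit (βf e)) (T : ℝ → Prop) {k : ℕ}
    (hexit : ∀ e : ℝ, 0 < e → ∀ γ : ℝ, 0 < γ →
      (∀ p ∈ B12Beta.HistBox γ k, (Sf e).β1 k p ≤ -((Sf e).β0 k)) → ¬ T e)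
    {c : ℝ} (hmem : ∃ e : ℝ, 0 < e ∧ (Sf e).β0 k ≤ c ∧ ∃ γ : ℝ, 0 < γ ∧ ∀ p ∈ B12Beta.HistBox γ k, (Sf e).β1 k p ≤ -c) :
    ∃ e : ℝ, 0 < e ∧ ¬ T e := by
  obtain ⟨e, he, hβ0, γ, hγ, hup⟩ := hmem
  exact ⟨e, he, hexit e he γ hγ fun p hp => (hup p hp).trans (neg_le_neg hβ0)⟩

/-- The shape this seat's (g) types (`hβ0 : ∀ e > 0, (Sf e).β0 = b0`, `hfam : ∀ s > 0, ∃ e > 0, ∃ γ > 0, RemainderConst (Sf e) γ s`, `b0 k < 0`)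
SUPPLIES `hmem` — using `hfam` at the single slope `s := −b0 k`, only the upper half of `|β¹| ≤ s`, only at scale `k`. [folklore] -/
theorem hmem_of_common_and_fam {βf : ℝ → HBeta} (Sf : (e : ℝ) → B12Beta.OneLoopSplit (βf e)) {b0 : ℕ → ℝ} {k : ℕ}
    (hβ0 : ∀ e : ℝ, 0 < e → (Sf e).β0 = b0)
    (hfam : ∀ s : ℝ, 0 < s → ∃ e : ℝ, 0 < e ∧ ∃ γ : ℝ, 0 < γ ∧ RemainderConst (Sf e) γ s) (hneg : b0 k < 0) :
    ∃ e : ℝ, 0 < e ∧ (Sf e).β0 k ≤ b0 k ∧ ∃ γ : ℝ, 0 < γ ∧ ∀ p ∈ B12Beta.HistBox γ k, (Sf e).β1 k p ≤ -(b0 k) := by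
  obtain ⟨e, he, γ, hγ, hR⟩ := hfam (-(b0 k)) (by linarith)
  exact ⟨e, he, (congrFun (hβ0 e he) k).le, γ, hγ, fun p hp => (abs_le.mp (hR k p hp)).2⟩

/-- Hence (g)'s `exists_member_not_thm2Printed_of_beta0_neg`, abstractly (with `T e := B12.Thm2Printed (Cf e) L` and `hexit` := (g)'s
`not_thm2Printed_of_beta0_neg_oneBox` per member, §6). [folklore] -/
theorem exists_member_exit {βf : ℝ → HBeta} (Sf : (e : ℝ) → B12Beta.OneLoopSplit (βf e)) (T : ℝ → Prop) {b0 : ℕ → ℝ} {k : ℕ}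
    (hexit : ∀ e : ℝ, 0 < e → ∀ γ : ℝ, 0 < γ →
      (∀ p ∈ B12Beta.HistBox γ k, (Sf e).β1 k p ≤ -((Sf e).β0 k)) → ¬ T e)
    (hβ0 : ∀ e : ℝ, 0 < e → (Sf e).β0 = b0)
    (hfam : ∀ s : ℝ, 0 < s → ∃ e : ℝ, 0 < e ∧ ∃ γ : ℝ, 0 < γ ∧ RemainderConst (Sf e) γ s) (hneg : b0 k < 0) :
    ∃ e : ℝ, 0 < e ∧ ¬ T e :=
  exists_member_exit_of_oneBox Sf T hexit (hmem_of_common_and_fam Sf hβ0 hfam hneg)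

/-! ## §2 (X-60) The print-faithful Theorem-2 hypothesis «for ε₁ sufficiently small» -/

/-- **X-60.**  If the family delivers, for every slope `s > 0`, members BELOW EVERY THRESHOLD `e₁` with remainder `≤ s` from above on one
box at scale `k` (`hthr`), then «`T e` for all sufficiently small `e`» (`∃ ε₀ > 0, ∀ e ∈ ]0,ε₀], T e` — the printed order of constants,
[II] p. 21 «ε₁ sufficiently small») already forces `0 ≤ c` for any common upper value `c` of the `k`-th coefficients of the small members.
As typed in (g), `hT : ∀ e > 0, T e` asks Theorem 2 of EVERY member, including large `ε₁` for which print claims nothing. [folklore] -/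
theorem coeff_nonneg_of_eventually {βf : ℝ → HBeta} (Sf : (e : ℝ) → B12Beta.OneLoopSplit (βf e)) (T : ℝ → Prop) {k : ℕ}
    (hexit : ∀ e : ℝ, 0 < e → ∀ γ : ℝ, 0 < γ →
      (∀ p ∈ B12Beta.HistBox γ k, (Sf e).β1 k p ≤ -((Sf e).β0 k)) → ¬ T e)
    {c ε₀ : ℝ} (hε₀ : 0 < ε₀) (hβ0 : ∀ e : ℝ, 0 < e → e ≤ ε₀ → (Sf e).β0 k ≤ c)
    (hthr : ∀ s : ℝ, 0 < s → ∀ e₁ : ℝ, 0 < e₁ →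
      ∃ e : ℝ, 0 < e ∧ e ≤ e₁ ∧ ∃ γ : ℝ, 0 < γ ∧ ∀ p ∈ B12Beta.HistBox γ k, (Sf e).β1 k p ≤ s)
    (hT : ∀ e : ℝ, 0 < e → e ≤ ε₀ → T e) : 0 ≤ c := by
  refine le_of_not_gt fun hc => ?_
  obtain ⟨e, he, hle, γ, hγ, hup⟩ := hthr (-c) (by linarith) ε₀ hε₀
  exact hexit e he γ hγ (fun p hp => (hup p hp).trans (neg_le_neg (hβ0 e he hle))) (hT e he hle)

/-- **`EpsFamily` delivers members below every threshold** (the definition quantifies over ALL `e ∈ ]0, ε₀]` with an `e`-UNIFORM bound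
`K` on `K_rem,L`): there are `K` and `ε₀ > 0` such that EVERY member `e ∈ ]0, ε₀]` satisfies the constant remainder form at every slope
`s ≥ e·K` on some box.  (Cf. `RemainderResidueFamily.atSlope_member_of_objectsFamily`, the same for `ObjectsFamily`; the typed
`exists_remainderConst_of_epsFamily` hides the member's size.) [cite: Balaban1988RG2Cluster, p.21; Balaban1987RG1, Thm 3 p.264] -/
theorem member_threshold_of_epsFamily {βf : ℝ → HBeta} {Sf : (e : ℝ) → B12Beta.OneLoopSplit (βf e)} (h : EpsFamily βf Sf) :
    ∃ K ε₀ : ℝ, 0 < ε₀ ∧ ∀ e : ℝ, 0 < e → e ≤ ε₀ → ∀ s : ℝ, e * K ≤ s →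
      ∃ γ₀ : ℝ, 0 < γ₀ ∧ RemainderConst (Sf e) γ₀ s := by
  obtain ⟨M, hM, μ, ν, ℓ, α₂, q, K, ε₀, cOf, hε₀, hall⟩ := h
  refine ⟨K, ε₀, hε₀, fun e he hle s hsK => ?_⟩
  obtain ⟨hε₁, hC, h22, hq, hsg, hKe, γ₀, hγ₀, hR⟩ := hall e he hle
  refine ⟨γ₀, hγ₀, remainderConst_of_atSlope ⟨M, hM, μ, ν, cOf e, ℓ, α₂, q, hR, hC, h22, hq, hsg, ?_⟩⟩
  rw [hε₁]
  exact (mul_le_mul_of_nonneg_left hKe he.le).trans hsK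

/-- Hence: for every slope `s > 0` and every threshold `e₁ > 0` SOME member `e ≤ e₁` has `RemainderConst (Sf e) γ₀ s` on some box.
[cite: Balaban1988RG2Cluster, p.21] -/
theorem exists_small_member_remainderConst_of_epsFamily {βf : ℝ → HBeta} {Sf : (e : ℝ) → B12Beta.OneLoopSplit (βf e)}
    (h : EpsFamily βf Sf) {s e₁ : ℝ} (hs : 0 < s) (he₁ : 0 < e₁) :
    ∃ e : ℝ, 0 < e ∧ e ≤ e₁ ∧ ∃ γ₀ : ℝ, 0 < γ₀ ∧ RemainderConst (Sf e) γ₀ s := by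
  obtain ⟨K, ε₀, hε₀, hall⟩ := member_threshold_of_epsFamily h
  -- the member: `min (min ε₀ e₁) (s / K)` if `K > 0`, else `min ε₀ e₁`
  obtain ⟨e, he, heε, he₁, heK⟩ : ∃ e : ℝ, 0 < e ∧ e ≤ ε₀ ∧ e ≤ e₁ ∧ e * K ≤ s := by
    by_cases hK : 0 < K
    · refine ⟨min (min ε₀ e₁) (s / K), lt_min (lt_min hε₀ he₁) (div_pos hs hK),
        (min_le_left _ _).trans (min_le_left _ _), (min_le_left _ _).trans (min_le_right _ _), ?_⟩
      calc min (min ε₀ e₁) (s / K) * K ≤ s / K * K := mul_le_mul_of_nonneg_right (min_le_right _ _) hK.le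
        _ = s := div_mul_cancel₀ s hK.ne'
    · exact ⟨min ε₀ e₁, lt_min hε₀ he₁, min_le_left _ _, min_le_right _ _,
        (mul_nonpos_iff.mpr (Or.inl ⟨(lt_min hε₀ he₁).le, not_lt.mp hK⟩)).trans hs.le⟩
  obtain ⟨γ₀, hγ₀, hR⟩ := hall e he heε s heK
  exact ⟨e, he, he₁, γ₀, hγ₀, hR⟩

/-- The threshold supplier `hthr` of `coeff_nonneg_of_eventually` from `EpsFamily` (upper half, one scale). [folklore] -/
theorem hthr_of_epsFamily {βf : ℝ → HBeta} {Sf : (e : ℝ) → B12Beta.OneLoopSplit (βf e)} (h : EpsFamily βf Sf) (k : ℕ) :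
    ∀ s : ℝ, 0 < s → ∀ e₁ : ℝ, 0 < e₁ →
      ∃ e : ℝ, 0 < e ∧ e ≤ e₁ ∧ ∃ γ : ℝ, 0 < γ ∧ ∀ p ∈ B12Beta.HistBox γ k, (Sf e).β1 k p ≤ s := by
  intro s hs e₁ he₁
  obtain ⟨e, he, hle, γ₀, hγ₀, hR⟩ := exists_small_member_remainderConst_of_epsFamily h hs he₁
  exact ⟨e, he, hle, γ₀, hγ₀, fun p hp => (abs_le.mp (hR k p hp)).2⟩

/-- **ASSEMBLED (X-60 over the (D4) family currency).**  `EpsFamily βf Sf` + the per-member one-box exit for `T` + `k`-th coefficients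
of the small members bounded above by `c` + «`T e` for all sufficiently small `e`» ⟹ `0 ≤ c`.  With `T e := B12.Thm2Printed (Cf e) L`
this is §6's `beta0_majorant_nonneg_of_thm2Printed_smallMembers`. [cite: Balaban1987RG1, Thm 2 (0.31) p.259 and Thm 3 p.264;
Balaban1988RG2Cluster, p.21] -/
theorem coeff_nonneg_of_eventually_epsFamily {βf : ℝ → HBeta} {Sf : (e : ℝ) → B12Beta.OneLoopSplit (βf e)} (h : EpsFamily βf Sf)
    (T : ℝ → Prop) {k : ℕ}
    (hexit : ∀ e : ℝ, 0 < e → ∀ γ : ℝ, 0 < γ →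
      (∀ p ∈ B12Beta.HistBox γ k, (Sf e).β1 k p ≤ -((Sf e).β0 k)) → ¬ T e)
    {c ε₀ : ℝ} (hε₀ : 0 < ε₀) (hβ0 : ∀ e : ℝ, 0 < e → e ≤ ε₀ → (Sf e).β0 k ≤ c)
    (hT : ∀ e : ℝ, 0 < e → e ≤ ε₀ → T e) : 0 ≤ c :=
  coeff_nonneg_of_eventually Sf T hexit hε₀ hβ0 (hthr_of_epsFamily h k) hT

/-- And its negative socket: a common upper value `c < 0` of the members' `k`-th coefficients ⟹ for EVERY threshold `ε₀ > 0` some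
member `e ≤ ε₀` violates `T` — «Theorem 2 fails for arbitrarily small ε₁», the print-faithful negation. [folklore] -/
theorem exists_small_member_exit_of_epsFamily {βf : ℝ → HBeta} {Sf : (e : ℝ) → B12Beta.OneLoopSplit (βf e)} (h : EpsFamily βf Sf)
    (T : ℝ → Prop) {k : ℕ}
    (hexit : ∀ e : ℝ, 0 < e → ∀ γ : ℝ, 0 < γ →
      (∀ p ∈ B12Beta.HistBox γ k, (Sf e).β1 k p ≤ -((Sf e).β0 k)) → ¬ T e)
    {c : ℝ} (hc : c < 0) (hβ0 : ∀ e : ℝ, 0 < e → (Sf e).β0 k ≤ c) {ε₀ : ℝ} (hε₀ : 0 < ε₀) :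
    ∃ e : ℝ, 0 < e ∧ e ≤ ε₀ ∧ ¬ T e := by
  by_contra hall
  have hT : ∀ e : ℝ, 0 < e → e ≤ ε₀ → T e := fun e he hle =>
    Classical.by_contradiction fun hne => hall ⟨e, he, hle, hne⟩
  exact absurd (coeff_nonneg_of_eventually_epsFamily h T hexit hε₀ (fun e he _ => hβ0 e he) hT) (not_le.mpr hc)


/-! ## §3 (X-64) The same threshold on the POSITIVE side: «for ALL sufficiently small ε₁», not «for some ε₁» -/

/-- **X-64, abstract.**  If a fixed slope `s₀ > 0` of the remainder on SOME box suffices for `T e` at every member (`hpos` — e.g. the positive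
socket `thm2Printed_of_floor_const` with `s₀ := b ∕ 2` below a common floor `b` of the one-loop coefficients), then `EpsFamily` gives `T e` for
ALL sufficiently small members: `∃ e₁ > 0, ∀ e ∈ ]0,e₁], T e` (`e₁ := min ε₀ (s₀ ∕ K)`).  The tree's `exists_member_thm2Printed_of_beta0Floor`
concludes only `∃ e > 0, T e`. [cite: Balaban1988RG2Cluster, p.21; Balaban1987RG1, Thm 3 p.264] -/
theorem forall_small_member_of_epsFamily {βf : ℝ → HBeta} {Sf : (e : ℝ) → B12Beta.OneLoopSplit (βf e)} (h : EpsFamily βf Sf)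
    (T : ℝ → Prop) {s₀ : ℝ} (hs₀ : 0 < s₀)
    (hpos : ∀ e : ℝ, 0 < e → ∀ γ₀ : ℝ, 0 < γ₀ → RemainderConst (Sf e) γ₀ s₀ → T e) :
    ∃ e₁ : ℝ, 0 < e₁ ∧ ∀ e : ℝ, 0 < e → e ≤ e₁ → T e := by
  obtain ⟨K, ε₀, hε₀, hall⟩ := member_threshold_of_epsFamily h
  by_cases hK : 0 < K
  · refine ⟨min ε₀ (s₀ / K), lt_min hε₀ (div_pos hs₀ hK), fun e he hle => ?_⟩
    have heK : e * K ≤ s₀ := by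
      calc e * K ≤ s₀ / K * K := mul_le_mul_of_nonneg_right (hle.trans (min_le_right _ _)) hK.le
        _ = s₀ := div_mul_cancel₀ s₀ hK.ne'
    obtain ⟨γ₀, hγ₀, hR⟩ := hall e he (hle.trans (min_le_left _ _)) s₀ heK
    exact hpos e he γ₀ hγ₀ hR
  · refine ⟨ε₀, hε₀, fun e he hle => ?_⟩
    have heK : e * K ≤ s₀ := (mul_nonpos_iff.mpr (Or.inl ⟨he.le, not_lt.mp hK⟩)).trans hs₀.le
    obtain ⟨γ₀, hγ₀, hR⟩ := hall e he hle s₀ heK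
    exact hpos e he γ₀ hγ₀ hR

/-- **X-64, concrete — THEOREM 2 AS PRINTED FOR ALL SUFFICIENTLY SMALL MEMBERS OF THE SCHEME, from a uniform positive floor of the common
one-loop part** (the hypotheses of the tree's `CapSignsConstRoad.exists_member_thm2Printed_of_beta0Floor`, verbatim; conclusion strengthened
from «∃ e > 0» to the print-faithful «∃ e₁ > 0, ∀ e ∈ ]0,e₁]»). [cite: Balaban1987RG1, Thm 2 p.259 with (0.31) and Thm 3 p.264;
Balaban1988RG2Cluster, p.21] -/
theorem forall_small_member_thm2Printed_of_beta0Floor {βf : ℝ → HBeta} {Sf : (e : ℝ) → B12Beta.OneLoopSplit (βf e)}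
    (hE : EpsFamily βf Sf) (Cf : ℝ → B12.Construction) (hgen : ∀ e, 0 < e → ForwardGenerated (Cf e) (βf e)) {L : ℝ}
    (hL : 1 < L) {b0 : ℕ → ℝ} (hβ0 : ∀ e, 0 < e → (Sf e).β0 = b0) {b : ℝ} (hb : 0 < b) (hF : ∀ k, b ≤ b0 k) (γcf β'f : ℝ → ℝ)
    (hγcf : ∀ e, 0 < e → 0 < γcf e) (hcont : ∀ e, 0 < e → BetaContH (γcf e) (βf e))
    (hup : ∀ e, 0 < e → BetaUpperH (β'f e) (γcf e) (βf e)) :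
    ∃ e₁ : ℝ, 0 < e₁ ∧ ∀ e : ℝ, 0 < e → e ≤ e₁ → B12.Thm2Printed (Cf e) L := by
  refine forall_small_member_of_epsFamily hE (fun e => B12.Thm2Printed (Cf e) L) (half_pos hb) fun e he γ₀ hγ₀ hR => ?_
  have hγ : 0 < min γ₀ (γcf e) := lt_min hγ₀ (hγcf e he)
  have hR' : RemainderConst (Sf e) (min γ₀ (γcf e)) (b / 2) := remainderConst_restrict (min_le_left _ _) hR
  have hF' : ∀ k, b ≤ (Sf e).β0 k := by rw [hβ0 e he]; exact hF
  exact thm2Printed_of_floor_const (hgen e he) hL (Sf e) hγ hF' hR' (half_lt_self hb)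
    (fun k => (hcont e he k).mono (box_mono (min_le_right _ _) k))
    (fun k v hv => hup e he k v (box_mono (min_le_right _ _) k hv))

/-- Packaged dichotomy of the scheme at the print-faithful quantifier: a common floor `b > 0` ⟹ Theorem 2 for ALL small members; a common
value `c < 0` above the members' `k`-th coefficients (with the per-member one-box exit) ⟹ for EVERY threshold some member below it
violates Theorem 2 (`exists_small_member_exit_of_epsFamily`).  [folklore] -/
theorem scheme_threshold_summary {βf : ℝ → HBeta} {Sf : (e : ℝ) → B12Beta.OneLoopSplit (βf e)} (hE : EpsFamily βf Sf)
    (T : ℝ → Prop) :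
    (∀ s₀ : ℝ, 0 < s₀ → (∀ e : ℝ, 0 < e → ∀ γ₀ : ℝ, 0 < γ₀ → RemainderConst (Sf e) γ₀ s₀ → T e) →
        ∃ e₁ : ℝ, 0 < e₁ ∧ ∀ e : ℝ, 0 < e → e ≤ e₁ → T e) ∧
      (∀ (k : ℕ) (c : ℝ), c < 0 →
        (∀ e : ℝ, 0 < e → ∀ γ : ℝ, 0 < γ → (∀ p ∈ B12Beta.HistBox γ k, (Sf e).β1 k p ≤ -((Sf e).β0 k)) → ¬ T e) →
        (∀ e : ℝ, 0 < e → (Sf e).β0 k ≤ c) → ∀ ε₀ : ℝ, 0 < ε₀ → ∃ e : ℝ, 0 < e ∧ e ≤ ε₀ ∧ ¬ T e) :=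
  ⟨fun _ hs₀ hpos => forall_small_member_of_epsFamily hE T hs₀ hpos,
    fun _ _ hc hexit hβ0 _ hε₀ => exists_small_member_exit_of_epsFamily hE T hexit hc hβ0 hε₀⟩


/-! ## §4 (X-65) The binder `hβ0` is used ONE-SIDEDLY: a common certified MINORANT suffices on the confirmation road -/

/-- The equality reading gives a minorant (so the tree's `exists_member_…` theorems and §3 are corollary cases of this §). [folklore] -/
theorem minorant_of_common {βf : ℝ → HBeta} {Sf : (e : ℝ) → B12Beta.OneLoopSplit (βf e)} {b0 : ℕ → ℝ}
    (hβ0 : ∀ e : ℝ, 0 < e → (Sf e).β0 = b0) : ∀ e : ℝ, 0 < e → ∀ k, b0 k ≤ (Sf e).β0 k :=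
  fun e he k => by rw [hβ0 e he]

/-- **X-65 — THEOREM 2 FOR ALL SMALL MEMBERS FROM A FLOOR OF A COMMON MINORANT** — `hβ0` of §3 ∕ of the tree's
`exists_member_thm2Printed_of_beta0Floor` replaced by the one-sided `hβ0le : ∀ e > 0, ∀ k, b0 k ≤ (Sf e).β0 k`; nothing else changes.
No claim that the one-loop coefficients are common to the members is needed. [cite: Balaban1987RG1, Thm 2 p.259 with (0.31) and Thm 3 p.264;
Balaban1988RG2Cluster, p.21] -/
theorem forall_small_member_thm2Printed_of_minorantFloor {βf : ℝ → HBeta} {Sf : (e : ℝ) → B12Beta.OneLoopSplit (βf e)}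
    (hE : EpsFamily βf Sf) (Cf : ℝ → B12.Construction) (hgen : ∀ e, 0 < e → ForwardGenerated (Cf e) (βf e)) {L : ℝ}
    (hL : 1 < L) {b0 : ℕ → ℝ} (hβ0le : ∀ e : ℝ, 0 < e → ∀ k, b0 k ≤ (Sf e).β0 k) {b : ℝ} (hb : 0 < b) (hF : ∀ k, b ≤ b0 k)
    (γcf β'f : ℝ → ℝ) (hγcf : ∀ e, 0 < e → 0 < γcf e) (hcont : ∀ e, 0 < e → BetaContH (γcf e) (βf e))
    (hup : ∀ e, 0 < e → BetaUpperH (β'f e) (γcf e) (βf e)) :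
    ∃ e₁ : ℝ, 0 < e₁ ∧ ∀ e : ℝ, 0 < e → e ≤ e₁ → B12.Thm2Printed (Cf e) L := by
  refine forall_small_member_of_epsFamily hE (fun e => B12.Thm2Printed (Cf e) L) (half_pos hb) fun e he γ₀ hγ₀ hR => ?_
  have hγ : 0 < min γ₀ (γcf e) := lt_min hγ₀ (hγcf e he)
  have hR' : RemainderConst (Sf e) (min γ₀ (γcf e)) (b / 2) := remainderConst_restrict (min_le_left _ _) hR
  have hF' : ∀ k, b ≤ (Sf e).β0 k := fun k => (hF k).trans (hβ0le e he k)
  exact thm2Printed_of_floor_const (hgen e he) hL (Sf e) hγ hF' hR' (half_lt_self hb)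
    (fun k => (hcont e he k).mono (box_mono (min_le_right _ _) k))
    (fun k v hv => hup e he k v (box_mono (min_le_right _ _) k hv))

/-- **X-65 — THEOREM 2 FOR ALL SMALL MEMBERS FROM THE SIGN LIST OF A COMMON CERTIFIED MINORANT** — the hypotheses of the tree's
`exists_member_thm2Printed_of_signs` with `hβ0` (equality) replaced by the minorant `hβ0le` (tail `GeomRate`, the ONE certified value, gap,
index test and SIGNS all on the minorant `b0`), conclusion the print-faithful «∃ e₁ > 0, ∀ e ∈ ]0,e₁]». [cite: Balaban1987RG1, Thm 2 p.259
with (0.31) and Thm 3 p.264; Balaban1988RG2Cluster, p.21] -/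
theorem forall_small_member_thm2Printed_of_minorantSigns {βf : ℝ → HBeta} {Sf : (e : ℝ) → B12Beta.OneLoopSplit (βf e)}
    (hE : EpsFamily βf Sf) (Cf : ℝ → B12.Construction) (hgen : ∀ e, 0 < e → ForwardGenerated (Cf e) (βf e)) {L : ℝ}
    (hL : 1 < L) {b0 : ℕ → ℝ} (hβ0le : ∀ e : ℝ, 0 < e → ∀ k, b0 k ≤ (Sf e).β0 k) {binf c₀ θ m : ℝ} {k₁ k₂ : ℕ} (hθ0 : 0 ≤ θ)
    (hθ1 : θ ≤ 1) (hconv : GeomRate b0 binf c₀ θ) (hcert : m ≤ b0 k₁) (hgap : c₀ * θ ^ k₁ < m)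
    (hk₂ : c₀ * θ ^ k₂ ≤ (m - c₀ * θ ^ k₁) / 4) (hsign : ∀ k, k < k₂ → 0 < b0 k) (γcf β'f : ℝ → ℝ)
    (hγcf : ∀ e, 0 < e → 0 < γcf e) (hcont : ∀ e, 0 < e → BetaContH (γcf e) (βf e))
    (hup : ∀ e, 0 < e → BetaUpperH (β'f e) (γcf e) (βf e)) :
    ∃ e₁ : ℝ, 0 < e₁ ∧ ∀ e : ℝ, 0 < e → e ≤ e₁ → B12.Thm2Printed (Cf e) L := by
  obtain ⟨f, hf, hF⟩ := exists_beta0Floor_of_signs b0 hθ0 hθ1 hconv hcert hgap hk₂ hsign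
  exact forall_small_member_thm2Printed_of_minorantFloor hE Cf hgen hL hβ0le hf hF γcf β'f hγcf hcont hup

/-- The tree's conclusion shape recovered (corollary; for comparison with `CapSignsConstRoad.exists_member_thm2Printed_of_signs`). [folklore] -/
theorem exists_member_thm2Printed_of_minorantSigns {βf : ℝ → HBeta} {Sf : (e : ℝ) → B12Beta.OneLoopSplit (βf e)}
    (hE : EpsFamily βf Sf) (Cf : ℝ → B12.Construction) (hgen : ∀ e, 0 < e → ForwardGenerated (Cf e) (βf e)) {L : ℝ}
    (hL : 1 < L) {b0 : ℕ → ℝ} (hβ0le : ∀ e : ℝ, 0 < e → ∀ k, b0 k ≤ (Sf e).β0 k) {binf c₀ θ m : ℝ} {k₁ k₂ : ℕ} (hθ0 : 0 ≤ θ)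
    (hθ1 : θ ≤ 1) (hconv : GeomRate b0 binf c₀ θ) (hcert : m ≤ b0 k₁) (hgap : c₀ * θ ^ k₁ < m)
    (hk₂ : c₀ * θ ^ k₂ ≤ (m - c₀ * θ ^ k₁) / 4) (hsign : ∀ k, k < k₂ → 0 < b0 k) (γcf β'f : ℝ → ℝ)
    (hγcf : ∀ e, 0 < e → 0 < γcf e) (hcont : ∀ e, 0 < e → BetaContH (γcf e) (βf e))
    (hup : ∀ e, 0 < e → BetaUpperH (β'f e) (γcf e) (βf e)) : ∃ e : ℝ, 0 < e ∧ B12.Thm2Printed (Cf e) L := by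
  obtain ⟨e₁, he₁, h⟩ :=
    forall_small_member_thm2Printed_of_minorantSigns hE Cf hgen hL hβ0le hθ0 hθ1 hconv hcert hgap hk₂ hsign γcf β'f hγcf hcont hup
  exact ⟨e₁, he₁, h e₁ he₁ le_rfl⟩


/-! ## §5 (this seat) The CONCRETE scheme sockets at the print-faithful quantifier — the one-box exit discharged by (g) -/

/-- The per-member ONE-BOX exit for `T e := B12.Thm2Printed (Cf e) L` is this seat's `CapSignsRefutationSocket.not_thm2Printed_of_beta0_neg_oneBox`
(forward generation only, `L > 1`). [cite: Balaban1987RG1, Thm 2 (0.31) p.259] -/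
theorem hexit_thm2Printed {βf : ℝ → HBeta} (Sf : (e : ℝ) → B12Beta.OneLoopSplit (βf e)) (Cf : ℝ → B12.Construction)
    (hgen : ∀ e, 0 < e → ForwardGenerated (Cf e) (βf e)) {L : ℝ} (hL : 1 < L) (k : ℕ) :
    ∀ e : ℝ, 0 < e → ∀ γ : ℝ, 0 < γ →
      (∀ p ∈ B12Beta.HistBox γ k, (Sf e).β1 k p ≤ -((Sf e).β0 k)) → ¬ B12.Thm2Printed (Cf e) L :=
  fun e he _ hγ hbox => not_thm2Printed_of_beta0_neg_oneBox (hgen e he) (Sf e) hγ hbox hL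

/-- **(N1) IN THE SCHEME CURRENCY AT THE PRINT-FAITHFUL QUANTIFIER.**  For an `EpsFamily` of splits over forward-generated constructions
`Cf e` and `L > 1`: if Theorem 2 as typed holds for all SUFFICIENTLY SMALL members (`∀ e ∈ ]0,ε₀]`, [II] p. 21 «ε₁ sufficiently small» — NOT
for every member) then every common MAJORANT `c` of the small members' `k`-th one-loop coefficients is `≥ 0`.  No continuity at the face,
no commonness of the coefficients, no (D4)-type bound beyond the family's own. (The tree's `beta0_nonneg_of_thm2Printed_epsFamily` is the
case «every member», `c := b0 k`.) [cite: Balaban1987RG1, Thm 2 (0.31) p.259 and Thm 3 p.264; Balaban1988RG2Cluster, p.21] -/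
theorem beta0_majorant_nonneg_of_thm2Printed_smallMembers {βf : ℝ → HBeta} {Sf : (e : ℝ) → B12Beta.OneLoopSplit (βf e)}
    (hE : EpsFamily βf Sf) (Cf : ℝ → B12.Construction) (hgen : ∀ e, 0 < e → ForwardGenerated (Cf e) (βf e)) {L : ℝ}
    (hL : 1 < L) {k : ℕ} {c ε₀ : ℝ} (hε₀ : 0 < ε₀) (hβ0 : ∀ e : ℝ, 0 < e → e ≤ ε₀ → (Sf e).β0 k ≤ c)
    (hT : ∀ e : ℝ, 0 < e → e ≤ ε₀ → B12.Thm2Printed (Cf e) L) : 0 ≤ c :=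
  coeff_nonneg_of_eventually_epsFamily hE (fun e => B12.Thm2Printed (Cf e) L) (hexit_thm2Printed Sf Cf hgen hL k) hε₀ hβ0 hT

/-- **THE PRINT-FAITHFUL NEGATIVE SOCKET OF THE SCHEME.**  A common majorant `c < 0` of the members' `k`-th one-loop coefficients at ONE
scale ⟹ below EVERY threshold `ε₀` some member `e ∈ ]0,ε₀]` violates Theorem 2 as typed — «(0.31) fails for arbitrarily small ε₁».
[cite: Balaban1987RG1, Thm 2 (0.31) p.259; Balaban1988RG2Cluster, p.21] -/
theorem exists_small_member_not_thm2Printed_of_majorant_neg {βf : ℝ → HBeta} {Sf : (e : ℝ) → B12Beta.OneLoopSplit (βf e)}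
    (hE : EpsFamily βf Sf) (Cf : ℝ → B12.Construction) (hgen : ∀ e, 0 < e → ForwardGenerated (Cf e) (βf e)) {L : ℝ}
    (hL : 1 < L) {k : ℕ} {c : ℝ} (hc : c < 0) (hβ0 : ∀ e : ℝ, 0 < e → (Sf e).β0 k ≤ c) {ε₀ : ℝ} (hε₀ : 0 < ε₀) :
    ∃ e : ℝ, 0 < e ∧ e ≤ ε₀ ∧ ¬ B12.Thm2Printed (Cf e) L :=
  exists_small_member_exit_of_epsFamily hE (fun e => B12.Thm2Printed (Cf e) L) (hexit_thm2Printed Sf Cf hgen hL k) hc hβ0 hε₀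

/-- **CERTIFICATE FORM**: a rational `hi < 0` majorising the members' `k`-th coefficients (what an ε₁-UNIFORM interval computation of the
one-loop coefficient at ONE scale would deliver) ⟹ below every threshold some member violates Theorem 2 as typed.  NO such certificate
exists to date. [cite: Balaban1987RG1, Thm 2 (0.31) p.259] -/
theorem exists_small_member_not_thm2Printed_cert {βf : ℝ → HBeta} {Sf : (e : ℝ) → B12Beta.OneLoopSplit (βf e)}
    (hE : EpsFamily βf Sf) (Cf : ℝ → B12.Construction) (hgen : ∀ e, 0 < e → ForwardGenerated (Cf e) (βf e)) {L : ℝ}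
    (hL : 1 < L) {k : ℕ} (hi : ℚ) (hhi : hi < 0) (hle : ∀ e : ℝ, 0 < e → (Sf e).β0 k ≤ ((hi : ℚ) : ℝ)) {ε₀ : ℝ}
    (hε₀ : 0 < ε₀) : ∃ e : ℝ, 0 < e ∧ e ≤ ε₀ ∧ ¬ B12.Thm2Printed (Cf e) L :=
  exists_small_member_not_thm2Printed_of_majorant_neg hE Cf hgen hL (by exact_mod_cast hhi) hle hε₀

/-- **The majorant need only hold for SMALL members** (g1-plan-2 GEN 11's X-69(b), adopted; kernel-checked by the planner as
`g1/skeletons/XreadP3G4_CapSchemeSocketWeakest_v1.probeX69b.NOT-TO-FILE.lean` 784e8d84c1bd3a3f): a common majorant `c < 0` of the `k`-th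
coefficients of the members `e ∈ ]0,ε₁]` ⟹ below EVERY threshold some member violates Theorem 2 as typed — so the refuting certificate on the
scheme road is an interval for β⁰_{k+1} uniform over SMALL ε₁ only. [cite: Balaban1987RG1, Thm 2 (0.31) p.259; Balaban1988RG2Cluster, p.21] -/
theorem exists_small_member_not_thm2Printed_of_majorant_neg_small {βf : ℝ → HBeta} {Sf : (e : ℝ) → B12Beta.OneLoopSplit (βf e)}
    (hE : EpsFamily βf Sf) (Cf : ℝ → B12.Construction) (hgen : ∀ e, 0 < e → ForwardGenerated (Cf e) (βf e)) {L : ℝ}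
    (hL : 1 < L) {k : ℕ} {c ε₁ : ℝ} (hc : c < 0) (hε₁ : 0 < ε₁) (hβ0 : ∀ e : ℝ, 0 < e → e ≤ ε₁ → (Sf e).β0 k ≤ c)
    {ε₀ : ℝ} (hε₀ : 0 < ε₀) : ∃ e : ℝ, 0 < e ∧ e ≤ ε₀ ∧ ¬ B12.Thm2Printed (Cf e) L := by
  by_contra hall
  have hT : ∀ e : ℝ, 0 < e → e ≤ min ε₀ ε₁ → B12.Thm2Printed (Cf e) L := fun e he hle =>
    Classical.by_contradiction fun hne => hall ⟨e, he, hle.trans (min_le_left _ _), hne⟩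
  have h0 := beta0_majorant_nonneg_of_thm2Printed_smallMembers hE Cf hgen hL (lt_min hε₀ hε₁)
    (fun e he hle => hβ0 e he (hle.trans (min_le_right _ _))) hT
  exact absurd h0 (not_le.mpr hc)

/-- **THE SCHEME'S TWO-SIDED TEST AT THE PRINT-FAITHFUL QUANTIFIER** (forward generation, `L > 1`, (C) and (U) per member on its own box):
a positive floor of a common MINORANT of the one-loop coefficients ⟹ Theorem 2 for ALL sufficiently small members; a negative common MAJORANT
at ONE scale ⟹ below every threshold some member violates it.  Equality of the members' coefficients is never used.
[cite: Balaban1987RG1, Thm 2 (0.31) p.259; Balaban1988RG2Cluster, p.21] -/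
theorem scheme_twoSidedTest {βf : ℝ → HBeta} {Sf : (e : ℝ) → B12Beta.OneLoopSplit (βf e)} (hE : EpsFamily βf Sf)
    (Cf : ℝ → B12.Construction) (hgen : ∀ e, 0 < e → ForwardGenerated (Cf e) (βf e)) {L : ℝ} (hL : 1 < L) (γcf β'f : ℝ → ℝ)
    (hγcf : ∀ e, 0 < e → 0 < γcf e) (hcont : ∀ e, 0 < e → BetaContH (γcf e) (βf e))
    (hup : ∀ e, 0 < e → BetaUpperH (β'f e) (γcf e) (βf e)) :
    (∀ b0 : ℕ → ℝ, (∀ e : ℝ, 0 < e → ∀ k, b0 k ≤ (Sf e).β0 k) → (∃ b : ℝ, 0 < b ∧ ∀ k, b ≤ b0 k) →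
        ∃ e₁ : ℝ, 0 < e₁ ∧ ∀ e : ℝ, 0 < e → e ≤ e₁ → B12.Thm2Printed (Cf e) L) ∧
      (∀ (k : ℕ) (c : ℝ), c < 0 → (∀ e : ℝ, 0 < e → (Sf e).β0 k ≤ c) →
        ∀ ε₀ : ℝ, 0 < ε₀ → ∃ e : ℝ, 0 < e ∧ e ≤ ε₀ ∧ ¬ B12.Thm2Printed (Cf e) L) :=
  ⟨fun _ hβ0le ⟨_, hb, hF⟩ => forall_small_member_thm2Printed_of_minorantFloor hE Cf hgen hL hβ0le hb hF γcf β'f hγcf hcont hup,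
    fun _ _ hc hβ0 _ hε₀ => exists_small_member_not_thm2Printed_of_majorant_neg hE Cf hgen hL hc hβ0 hε₀⟩

end

end Summit.QuantumFields.BalabanUV.Gaps.CapSchemeSocketWeakest
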